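import Mathlib
import HarnessLib
import Summits.SmoothPoincare4.SmoothPoincare4.Theorems.EntropyRungConicalGapWeightedMassContinuity

/-! # Stubs `helper_scaleDerivatives` and `helper_coneExcess_hasDerivAt` of line `Sketch`
(crux `EntropyRung.ConicalGap`, stmt-SmoothPoincare4-16589)

Pure measure theory / calculus: the scale derivatives of the three weighted masses

  `Z(τ) = ∫ e^{-f/τ} dμ`, `F(τ) = ∫ f e^{-f/τ} dμ`, `N(τ) = ∫ R e^{-f/τ} dμ`

of a measure space `(X, μ)` with measurable `f ≥ 0` and measurable `R`. Since
`∂_s e^{-f/s} = f s⁻² e^{-f/s}`, differentiation under the integral sign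
(`hasDerivAt_integral_of_dominated_loc_of_deriv_le`) gives

  `Z′(τ) = τ⁻² F(τ)`, `F′(τ) = τ⁻² ∫ f² e^{-f/τ} dμ`, `N′(τ) = τ⁻² ∫ f R e^{-f/τ} dμ`

(`helper_scaleDerivatives`), provided the weights `w e^{-f/τ}` and `w f e^{-f/τ}` (`w = 1, f, R`) are
integrable at every scale. The domination on the neighbourhood `(τ/2, 2τ)` of the scale `τ > 0` is by
`(τ/2)⁻² |w f| e^{-f/(2τ)}`: for `τ/2 < s < 2τ` one has `s⁻² ≤ (τ/2)⁻²` and, because `f ≥ 0`,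
`e^{-f/s} ≤ e^{-f/(2τ)}` (`weightedMass_exp_le`). One parametrised lemma
`scaleDerivatives_hasDerivAt` (general measurable weight `w`, with `g = w f`) gives the three clauses as
the instances `w = 1, f, R`.

The second stub `helper_coneExcess_hasDerivAt` is the quotient rule for the cone-excess profile
`m(s) = s N(s)/Z(s)`: if `Z′(τ) = τ⁻² F` and `N′(τ) = τ⁻² G` with `τ ≠ 0`, `Z(τ) ≠ 0`, then
`m′(τ) = N/Z + τ⁻¹ (G/Z − (F/Z)(N/Z))`.

The hypothesis `R ≥ 0` is part of the registered signature of `helper_scaleDerivatives` but is not used.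
Everything here is proved from Mathlib; no definition and no named fact is introduced.
-/

noncomputable section

-- `Summit.SmoothPoincare4.SmoothPoincare4.…` (summit = problem) trips `dupNamespace` on every decl.
set_option linter.dupNamespace false

open scoped Topology
open MeasureTheory Set Filter

namespace Summit.SmoothPoincare4.SmoothPoincare4.Theorems.ConicalGapSketch

/-- Pointwise scale derivative of the weight: for `s ≠ 0` and `g₀ = w₀ f₀`,
`∂_s (w₀ e^{-f₀/s}) = s⁻² g₀ e^{-f₀/s}`. -/
theorem scaleDerivatives_pointwise (w₀ f₀ g₀ : ℝ) (hg : w₀ * f₀ = g₀) {s : ℝ} (hs : s ≠ 0) :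
    HasDerivAt (fun σ : ℝ ↦ w₀ * Real.exp (-f₀ / σ))
      ((s ^ 2)⁻¹ * (g₀ * Real.exp (-f₀ / s))) s := by
  have h := (((hasDerivAt_const s (-f₀)).fun_div (hasDerivAt_id' (x := s)) hs).exp).const_mul w₀
  refine h.congr_deriv ?_
  rw [← hg]
  field_simp
  ring

/-- **Scale derivative of a weighted mass** (differentiation under the integral sign): for measurable
`f ≥ 0`, a measurable weight `w`, `g = w f`, and a scale `τ > 0` with `w e^{-f/τ}` and
`g e^{-f/(2τ)}` integrable, the weighted mass `s ↦ ∫ w e^{-f/s} dμ` has derivative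
`τ⁻² ∫ g e^{-f/τ} dμ` at `τ`. The dominating function on the neighbourhood `(τ/2, 2τ)` is
`(τ/2)⁻² |g| e^{-f/(2τ)}`. -/
theorem scaleDerivatives_hasDerivAt {X : Type*} [MeasurableSpace X] {μ : Measure X}
    {f w g : X → ℝ} (hf : Measurable f) (hw : Measurable w) (hf0 : ∀ x, 0 ≤ f x)
    (hg : ∀ x, w x * f x = g x) {τ : ℝ} (hτ : 0 < τ)
    (hInt : Integrable (fun x ↦ w x * Real.exp (-f x / τ)) μ)
    (hInt2 : Integrable (fun x ↦ g x * Real.exp (-f x / (2 * τ))) μ) :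
    HasDerivAt (fun s : ℝ ↦ ∫ x, w x * Real.exp (-f x / s) ∂μ)
      ((τ ^ 2)⁻¹ * ∫ x, g x * Real.exp (-f x / τ) ∂μ) τ := by
  have hmem : Ioo (τ / 2) (2 * τ) ∈ 𝓝 τ := Ioo_mem_nhds (by linarith) (by linarith)
  have hgm : Measurable g := by
    have h : g = fun x ↦ w x * f x := funext fun x ↦ (hg x).symm
    rw [h]
    exact hw.mul hf
  have hkey := hasDerivAt_integral_of_dominated_loc_of_deriv_le (μ := μ)
    (F := fun s x ↦ w x * Real.exp (-f x / s))
    (F' := fun s x ↦ (s ^ 2)⁻¹ * (g x * Real.exp (-f x / s)))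
    (bound := fun x ↦ ((τ / 2) ^ 2)⁻¹ * (|g x| * Real.exp (-f x / (2 * τ)))) hmem ?_ hInt ?_ ?_ ?_ ?_
  · refine hkey.2.congr_deriv ?_
    exact integral_const_mul _ _
  · exact Eventually.of_forall fun s ↦ (hw.mul (hf.neg.div_const s).exp).aestronglyMeasurable
  · exact ((hgm.mul (hf.neg.div_const τ).exp).const_mul _).aestronglyMeasurable
  · refine Eventually.of_forall fun x s hs ↦ ?_
    have hspos : 0 < s := lt_trans (by linarith) hs.1
    have h1 : (s ^ 2)⁻¹ ≤ ((τ / 2) ^ 2)⁻¹ :=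
      inv_anti₀ (by positivity) (pow_le_pow_left₀ (by linarith) hs.1.le 2)
    have h2 : Real.exp (-f x / s) ≤ Real.exp (-f x / (2 * τ)) :=
      weightedMass_exp_le (hf0 x) hspos hs.2.le
    rw [norm_mul, norm_mul, norm_inv, norm_pow, Real.norm_of_nonneg hspos.le, Real.norm_eq_abs,
      Real.norm_eq_abs, Real.abs_exp]
    exact mul_le_mul h1 (mul_le_mul_of_nonneg_left h2 (abs_nonneg _)) (by positivity)
      (by positivity)
  · refine (hInt2.abs.congr (Eventually.of_forall fun x ↦ ?_)).const_mul _
    simp only [abs_mul, Real.abs_exp]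
  · refine Eventually.of_forall fun x s hs ↦ ?_
    have hspos : 0 < s := lt_trans (by linarith) hs.1
    exact scaleDerivatives_pointwise (w x) (f x) (g x) (hg x) hspos.ne'

/-- **Helper of line `Sketch`** (scale derivatives of the weighted masses; pure measure theory): for any
measure `μ`, measurable `f, R ≥ 0` with `e^{-f/τ}`, `f e^{-f/τ}`, `R e^{-f/τ}`, `f² e^{-f/τ}`,
`f R e^{-f/τ}` integrable for every `τ > 0`, the three weighted masses
`Z(s) = ∫ e^{-f/s} dμ`, `F(s) = ∫ f e^{-f/s} dμ`, `N(s) = ∫ R e^{-f/s} dμ` are differentiable at every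
`τ > 0` with `Z′(τ) = τ⁻² ∫ f e^{-f/τ}`, `F′(τ) = τ⁻² ∫ f² e^{-f/τ}`, `N′(τ) = τ⁻² ∫ f R e^{-f/τ}`. -/
theorem helper_scaleDerivatives : ∀ (X : Type) [MeasurableSpace X] (μ : MeasureTheory.Measure X) (f R : X → ℝ), Measurable f → Measurable R → (∀ x, 0 ≤ f x) → (∀ x, 0 ≤ R x) → (∀ τ : ℝ, 0 < τ → MeasureTheory.Integrable (fun x ↦ Real.exp (-f x / τ)) μ ∧ MeasureTheory.Integrable (fun x ↦ f x * Real.exp (-f x / τ)) μ ∧ MeasureTheory.Integrable (fun x ↦ R x * Real.exp (-f x / τ)) μ) → (∀ τ : ℝ, 0 < τ → MeasureTheory.Integrable (fun x ↦ f x ^ 2 * Real.exp (-f x / τ)) μ ∧ MeasureTheory.Integrable (fun x ↦ f x * R x * Real.exp (-f x / τ)) μ) → ∀ τ : ℝ, 0 < τ → HasDerivAt (fun s : ℝ ↦ ∫ x, Real.exp (-f x / s) ∂μ) ((τ ^ 2)⁻¹ * ∫ x, f x * Real.exp (-f x / τ) ∂μ) τ ∧ HasDerivAt (fun s : ℝ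 ↦ ∫ x, f x * Real.exp (-f x / s) ∂μ) ((τ ^ 2)⁻¹ * ∫ x, f x ^ 2 * Real.exp (-f x / τ) ∂μ) τ ∧ HasDerivAt (fun s : ℝ ↦ ∫ x, R x * Real.exp (-f x / s) ∂μ) ((τ ^ 2)⁻¹ * ∫ x, f x * R x * Real.exp (-f x / τ) ∂μ) τ := by
  intro X _ μ f R hf hR hf0 _ hInt hInt2 τ hτ
  have h2τ : (0 : ℝ) < 2 * τ := by positivity
  refine ⟨?_, ?_, ?_⟩
  · have h1 : Integrable (fun x ↦ (1 : ℝ) * Real.exp (-f x / τ)) μ := by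
      simpa only [one_mul] using (hInt τ hτ).1
    simpa only [one_mul] using
      scaleDerivatives_hasDerivAt (w := fun _ ↦ (1 : ℝ)) (g := f) hf measurable_const hf0
        (fun x ↦ one_mul (f x)) hτ h1 (hInt _ h2τ).2.1
  · exact scaleDerivatives_hasDerivAt (g := fun x ↦ f x ^ 2) hf hf hf0 (fun x ↦ (sq (f x)).symm)
      hτ (hInt τ hτ).2.1 (hInt2 _ h2τ).1
  · exact scaleDerivatives_hasDerivAt (g := fun x ↦ f x * R x) hf hR hf0
      (fun x ↦ mul_comm (R x) (f x)) hτ (hInt τ hτ).2.2 (hInt2 _ h2τ).2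

/-- **Helper of line `Sketch`** (derivative of the cone-excess profile; pure calculus): if
`Z′(τ) = τ⁻² F` and `N′(τ) = τ⁻² G` at a scale `τ ≠ 0` with `Z(τ) ≠ 0`, then
`m(s) = s N(s)/Z(s)` has derivative `N/Z + τ⁻¹ (G/Z − (F/Z)(N/Z))` at `τ`. -/
theorem helper_coneExcess_hasDerivAt : ∀ (Z N : ℝ → ℝ) (τ F G : ℝ), τ ≠ 0 → Z τ ≠ 0 → HasDerivAt Z ((τ ^ 2)⁻¹ * F) τ → HasDerivAt N ((τ ^ 2)⁻¹ * G) τ → HasDerivAt (fun s : ℝ ↦ s * (N s / Z s)) (N τ / Z τ + τ⁻¹ * (G / Z τ - (F / Z τ) * (N τ / Z τ))) τ := by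
  intro Z N τ F G hτ hZτ hZ hN
  have h := (hasDerivAt_id' (x := τ)).fun_mul (hN.fun_div hZ hZτ)
  refine h.congr_deriv ?_
  field_simp

end Summit.SmoothPoincare4.SmoothPoincare4.Theorems.ConicalGapSketch

end
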